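import Mathlib
import HarnessLib

/-!
# The rung-2 strain(+swirl) sector of `NS₂`: the exact centre law is LOCAL — an exact primitive
(Negative lane bookkeeping, supports `RungBlowupCofinal` / BC5 rung 2; circuit seat g9)

MODEL, NOT NS.  The closed axisymmetric strain + swirl sector of the degree-`2` angular Galerkin truncation `NS₂`
(`u = P₂[a(r)E] + T₁[b(r)e₃]`, `E = diag(−½,−½,1)`; HOME/circuit/agl/AGL-RUNG2-STRUCTURE.md §3, evidence #8/#11/#35 on
stmt-NavierStokesRegularity-19959) is the pair of radial equations

  `bₜ = ν𝓛₅b + 3ab + (3/5) r (ab)′`,  `𝓛₇(aₜ − ν𝓛₇a) = Q[a] − (4/3) b b′/r`,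
  `Q[a] = −½[(216/7) a a′/r + (78/7) a a″ + (6/7) r a a‴ + (72/7) a′² + (12/7) r a′a″]`,  `𝓛₇ = ∂ᵣ² + (6/r)∂ᵣ`,

so that `aₜ = ν𝓛₇a + q` with `q` the decaying solution of `𝓛₇q = Q[a] − (4/3)bb′/r`.  The centre strain rate
`ȧ(0)` therefore involves `q(0) = −(1/5)∫₀^∞ r (𝓛₇q) dr`, a WHOLE-PROFILE integral — yet it is LOCAL:
`∫₀^∞ r Q[a] dr = (75/14) a(0)²` for every profile (the `∫ r a′²` terms cancel), giving the exact centre law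

  `ȧ₀ = 7ν a″(0) − (15/14) a₀² − (2/15) b₀²`   (`s = 3a₀`, `Ω = b₀`: `ṡ = −(5/14)s² − (2/5)Ω² + 21νa″(0)`),

i.e. restricted Euler with Vieillefosse's coefficients `(½, ⅔)` renormalised to `(5/14, 2/5)` — the in-run monitor «T4» of
both rung-2 engines (circuit `sector2.py`/`ns2.py`, machine check kit j260236 on six test shapes).

THIS FILE makes the locality a kernel fact for ALL profiles by exhibiting the primitive behind it:

* `hasDerivAt_centrePrimitive` : `r·Q[a](r) = −½ · d/dr [ (75/7) a² + (66/7) r a a′ + (6/7) r² a a″ + (3/7) r² a′² ]`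
  (pointwise, for any `C³` germ) — the reason the `∫ r a′²` terms cancel is that the integrand is an exact derivative;
* `integral_Ioi_r_mul_source` : `∫₀^∞ r Q[a] dr = (75/14) a(0)²` for every `C³` profile whose primitive tends to `0`;
* `integral_Ioi_b_mul_deriv` : `∫₀^∞ b b′ = −½ b(0)²`;  `integral_Ioi_r_mul_L7` : `∫₀^∞ r 𝓛₇q dr = −5 q(0)`
  (`r 𝓛₇q = (r q′ + 5q)′`) for every `C²` function `q` with `q → 0`, `r q′ → 0`;
* `centre_value_of_poisson` : hence the decaying solution of `𝓛₇q = Q[a] − (4/3)bb′/r` has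
  `q(0) = −(15/14) a(0)² − (2/15) b(0)²`, and `centreLaw` : `ȧ₀ = 7ν a″(0) − (15/14)a₀² − (2/15)b₀²` once the sector
  equation is read at `r = 0` (`(𝓛₇a)(0) = 7a″(0)` for an even `C²` germ, supplied as the hypothesis it is).

All statements are about real functions of one variable with explicit hypotheses (no PDE predicate is defined here; the
identification of the sector equations with `NS₂` is the machine-identified channel table of AGL-RUNG2-STRUCTURE §1, not a
Lean theorem).  Nothing in this file asserts a Theses declaration; numerics never move items.
-/

namespace Summit.NavierStokesRegularity.RungBlowupCofinalStrainSectorCentreLaw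

open MeasureTheory Set Filter Topology

/-- **The exact primitive behind the locality of the rung-2 centre law.**  For a `C³` germ `a` at `r`
(`a′ = a1`, `a1′ = a2`, `a2′ = a3` at `r`), the radially weighted quadrupole self-straining source satisfies
`r·Q[a](r) = −½ F′(r)` with `F = (75/7)a² + (66/7) r a a′ + (6/7) r² a a″ + (3/7) r² a′²`; stated as the derivative of
`F` being `−2 r Q[a](r) = (216/7) a a′ + (78/7) r a a″ + (6/7) r² a a‴ + (72/7) r a′² + (12/7) r² a′ a″`. -/
theorem hasDerivAt_centrePrimitive {a a1 a2 a3 : ℝ → ℝ} {r : ℝ}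
    (h0 : HasDerivAt a (a1 r) r) (h1 : HasDerivAt a1 (a2 r) r) (h2 : HasDerivAt a2 (a3 r) r) :
    HasDerivAt (fun x => (75 / 7) * (a x * a x) + (66 / 7) * (x * (a x * a1 x))
        + (6 / 7) * (x * x * (a x * a2 x)) + (3 / 7) * (x * x * (a1 x * a1 x)))
      ((216 / 7) * a r * a1 r + (78 / 7) * r * a r * a2 r + (6 / 7) * r ^ 2 * a r * a3 r
        + (72 / 7) * r * a1 r ^ 2 + (12 / 7) * r ^ 2 * a1 r * a2 r) r := by
  have hx : HasDerivAt (fun x : ℝ => x) 1 r := hasDerivAt_id' r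
  have hF := ((((h0.fun_mul h0).const_mul (75 / 7)).fun_add ((hx.fun_mul (h0.fun_mul h1)).const_mul (66 / 7))).fun_add
    (((hx.fun_mul hx).fun_mul (h0.fun_mul h2)).const_mul (6 / 7))).fun_add
    (((hx.fun_mul hx).fun_mul (h1.fun_mul h1)).const_mul (3 / 7))
  exact hF.congr_deriv (by ring)

/-- **`∫₀^∞ r Q[a] dr = (75/14) a(0)²` for every `C³` profile** whose centre primitive
`F = (75/7)a² + (66/7) r a a′ + (6/7) r² a a″ + (3/7) r² a′²` tends to `0` at infinity (e.g. `a, r a′, r² a″ → 0`) and whose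
weighted source is integrable: the whole-profile integral that gives the centre strain rate is LOCAL.  (Stated for
`−2 r Q[a]`: its integral over `(0, ∞)` is `−(75/7) a(0)²`.) -/
theorem integral_Ioi_neg_two_r_mul_source {a a1 a2 a3 : ℝ → ℝ}
    (h0 : ∀ r ∈ Ici (0 : ℝ), HasDerivAt a (a1 r) r) (h1 : ∀ r ∈ Ici (0 : ℝ), HasDerivAt a1 (a2 r) r)
    (h2 : ∀ r ∈ Ici (0 : ℝ), HasDerivAt a2 (a3 r) r)
    (hint : IntegrableOn (fun r => (216 / 7) * a r * a1 r + (78 / 7) * r * a r * a2 r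
        + (6 / 7) * r ^ 2 * a r * a3 r + (72 / 7) * r * a1 r ^ 2 + (12 / 7) * r ^ 2 * a1 r * a2 r) (Ioi 0))
    (hlim : Tendsto (fun x => (75 / 7) * (a x * a x) + (66 / 7) * (x * (a x * a1 x))
        + (6 / 7) * (x * x * (a x * a2 x)) + (3 / 7) * (x * x * (a1 x * a1 x))) atTop (𝓝 0)) :
    ∫ r in Ioi (0 : ℝ), ((216 / 7) * a r * a1 r + (78 / 7) * r * a r * a2 r
        + (6 / 7) * r ^ 2 * a r * a3 r + (72 / 7) * r * a1 r ^ 2 + (12 / 7) * r ^ 2 * a1 r * a2 r)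
      = -(75 / 7) * a 0 ^ 2 := by
  rw [integral_Ioi_of_hasDerivAt_of_tendsto'
    (fun r hr => hasDerivAt_centrePrimitive (h0 r hr) (h1 r hr) (h2 r hr)) hint hlim]
  ring

/-- **`∫₀^∞ r Q[a] dr = (75/14) a(0)²`** (the form used in the memo): with `rQ r = −½ · (−2 r Q[a](r))` pointwise on
`(0, ∞)`. -/
theorem integral_Ioi_r_mul_source {a a1 a2 a3 rQ : ℝ → ℝ}
    (h0 : ∀ r ∈ Ici (0 : ℝ), HasDerivAt a (a1 r) r) (h1 : ∀ r ∈ Ici (0 : ℝ), HasDerivAt a1 (a2 r) r)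
    (h2 : ∀ r ∈ Ici (0 : ℝ), HasDerivAt a2 (a3 r) r)
    (hrQ : ∀ r ∈ Ioi (0 : ℝ), rQ r = -(1 / 2) * ((216 / 7) * a r * a1 r + (78 / 7) * r * a r * a2 r
        + (6 / 7) * r ^ 2 * a r * a3 r + (72 / 7) * r * a1 r ^ 2 + (12 / 7) * r ^ 2 * a1 r * a2 r))
    (hint : IntegrableOn (fun r => (216 / 7) * a r * a1 r + (78 / 7) * r * a r * a2 r
        + (6 / 7) * r ^ 2 * a r * a3 r + (72 / 7) * r * a1 r ^ 2 + (12 / 7) * r ^ 2 * a1 r * a2 r) (Ioi 0))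
    (hlim : Tendsto (fun x => (75 / 7) * (a x * a x) + (66 / 7) * (x * (a x * a1 x))
        + (6 / 7) * (x * x * (a x * a2 x)) + (3 / 7) * (x * x * (a1 x * a1 x))) atTop (𝓝 0)) :
    ∫ r in Ioi (0 : ℝ), rQ r = (75 / 14) * a 0 ^ 2 := by
  have hcongr : ∫ r in Ioi (0 : ℝ), rQ r = ∫ r in Ioi (0 : ℝ), -(1 / 2) * ((216 / 7) * a r * a1 r
      + (78 / 7) * r * a r * a2 r + (6 / 7) * r ^ 2 * a r * a3 r + (72 / 7) * r * a1 r ^ 2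
      + (12 / 7) * r ^ 2 * a1 r * a2 r) :=
    setIntegral_congr_fun measurableSet_Ioi hrQ
  rw [hcongr, integral_const_mul, integral_Ioi_neg_two_r_mul_source h0 h1 h2 hint hlim]
  ring

/-- **Swirl contribution**: `∫₀^∞ b b′ = −½ b(0)²` for a `C¹` function with `b → 0` at infinity and `b b′`
integrable (the term `−(4/3) b b′/r` of the sector equation, weighted by `r`). -/
theorem integral_Ioi_b_mul_deriv {b b1 : ℝ → ℝ} (h0 : ∀ r ∈ Ici (0 : ℝ), HasDerivAt b (b1 r) r)
    (hint : IntegrableOn (fun r => b r * b1 r) (Ioi 0)) (hlim : Tendsto b atTop (𝓝 0)) :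
    ∫ r in Ioi (0 : ℝ), b r * b1 r = -(1 / 2) * b 0 ^ 2 := by
  have hder : ∀ r ∈ Ici (0 : ℝ), HasDerivAt (fun x => (1 / 2) * (b x * b x)) (b r * b1 r) r := by
    intro r hr
    have h := ((h0 r hr).fun_mul (h0 r hr)).const_mul (1 / 2)
    exact h.congr_deriv (by ring)
  have hlim' : Tendsto (fun x => (1 / 2) * (b x * b x)) atTop (𝓝 0) := by
    have := (hlim.mul hlim).const_mul (1 / 2)
    simpa using this
  rw [integral_Ioi_of_hasDerivAt_of_tendsto' hder hint hlim']
  ring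

/-- **Green's identity for `𝓛₇` at the centre**: `r 𝓛₇q = r q″ + 6 q′ = (r q′ + 5 q)′`, hence
`∫₀^∞ r 𝓛₇q dr = −5 q(0)` for every `C²` function with `q → 0` and `r q′ → 0` at infinity — the value at the
origin of the decaying solution of `𝓛₇q = S` is `−(1/5)∫₀^∞ r S`. -/
theorem integral_Ioi_r_mul_L7 {q q1 q2 : ℝ → ℝ} (h0 : ∀ r ∈ Ici (0 : ℝ), HasDerivAt q (q1 r) r)
    (h1 : ∀ r ∈ Ici (0 : ℝ), HasDerivAt q1 (q2 r) r)
    (hint : IntegrableOn (fun r => r * q2 r + 6 * q1 r) (Ioi 0)) (hq : Tendsto q atTop (𝓝 0))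
    (hrq : Tendsto (fun r => r * q1 r) atTop (𝓝 0)) :
    ∫ r in Ioi (0 : ℝ), (r * q2 r + 6 * q1 r) = -5 * q 0 := by
  have hder : ∀ r ∈ Ici (0 : ℝ), HasDerivAt (fun x => x * q1 x + 5 * q x) (r * q2 r + 6 * q1 r) r := by
    intro r hr
    have h := ((hasDerivAt_id' r).fun_mul (h1 r hr)).fun_add ((h0 r hr).const_mul 5)
    exact h.congr_deriv (by ring)
  have hlim' : Tendsto (fun x => x * q1 x + 5 * q x) atTop (𝓝 0) := by
    have := hrq.add (hq.const_mul 5)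
    simpa using this
  rw [integral_Ioi_of_hasDerivAt_of_tendsto' hder hint hlim']
  ring

/-- **The centre value of the pressure-like potential.**  Let `a` be a `C³` profile and `b` a `C¹` swirl profile with
the decay of the two previous lemmas, and let `q` be a `C²` function with `q → 0`, `r q′ → 0` solving the radially
weighted sector Poisson equation `r 𝓛₇q = r Q[a] − (4/3) b b′` on `(0, ∞)`.  Then
`q(0) = −(15/14) a(0)² − (2/15) b(0)²`. -/
theorem centre_value_of_poisson {a a1 a2 a3 b b1 q q1 q2 : ℝ → ℝ}
    (ha0 : ∀ r ∈ Ici (0 : ℝ), HasDerivAt a (a1 r) r) (ha1 : ∀ r ∈ Ici (0 : ℝ), HasDerivAt a1 (a2 r) r)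
    (ha2 : ∀ r ∈ Ici (0 : ℝ), HasDerivAt a2 (a3 r) r)
    (haint : IntegrableOn (fun r => (216 / 7) * a r * a1 r + (78 / 7) * r * a r * a2 r
        + (6 / 7) * r ^ 2 * a r * a3 r + (72 / 7) * r * a1 r ^ 2 + (12 / 7) * r ^ 2 * a1 r * a2 r) (Ioi 0))
    (halim : Tendsto (fun x => (75 / 7) * (a x * a x) + (66 / 7) * (x * (a x * a1 x))
        + (6 / 7) * (x * x * (a x * a2 x)) + (3 / 7) * (x * x * (a1 x * a1 x))) atTop (𝓝 0))
    (hb0 : ∀ r ∈ Ici (0 : ℝ), HasDerivAt b (b1 r) r) (hbint : IntegrableOn (fun r => b r * b1 r) (Ioi 0))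
    (hblim : Tendsto b atTop (𝓝 0))
    (hq0 : ∀ r ∈ Ici (0 : ℝ), HasDerivAt q (q1 r) r) (hq1 : ∀ r ∈ Ici (0 : ℝ), HasDerivAt q1 (q2 r) r)
    (hq : Tendsto q atTop (𝓝 0)) (hrq : Tendsto (fun r => r * q1 r) atTop (𝓝 0))
    (hpoisson : ∀ r ∈ Ioi (0 : ℝ), r * q2 r + 6 * q1 r = -(1 / 2) * ((216 / 7) * a r * a1 r
        + (78 / 7) * r * a r * a2 r + (6 / 7) * r ^ 2 * a r * a3 r + (72 / 7) * r * a1 r ^ 2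
        + (12 / 7) * r ^ 2 * a1 r * a2 r) - (4 / 3) * (b r * b1 r)) :
    q 0 = -(15 / 14) * a 0 ^ 2 - (2 / 15) * b 0 ^ 2 := by
  have hS : IntegrableOn (fun r => -(1 / 2) * ((216 / 7) * a r * a1 r
        + (78 / 7) * r * a r * a2 r + (6 / 7) * r ^ 2 * a r * a3 r + (72 / 7) * r * a1 r ^ 2
        + (12 / 7) * r ^ 2 * a1 r * a2 r) - (4 / 3) * (b r * b1 r)) (Ioi 0) :=
    (haint.const_mul _).sub (hbint.const_mul _)
  have hLint : IntegrableOn (fun r => r * q2 r + 6 * q1 r) (Ioi 0) :=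
    hS.congr_fun (fun r hr => (hpoisson r hr).symm) measurableSet_Ioi
  have hG := integral_Ioi_r_mul_L7 hq0 hq1 hLint hq hrq
  have hcongr : ∫ r in Ioi (0 : ℝ), (r * q2 r + 6 * q1 r) = ∫ r in Ioi (0 : ℝ), (-(1 / 2) * ((216 / 7) * a r * a1 r
        + (78 / 7) * r * a r * a2 r + (6 / 7) * r ^ 2 * a r * a3 r + (72 / 7) * r * a1 r ^ 2
        + (12 / 7) * r ^ 2 * a1 r * a2 r) - (4 / 3) * (b r * b1 r)) :=
    setIntegral_congr_fun measurableSet_Ioi hpoisson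
  rw [hcongr, integral_sub (haint.const_mul _) (hbint.const_mul _), integral_const_mul, integral_const_mul,
    integral_Ioi_neg_two_r_mul_source ha0 ha1 ha2 haint halim, integral_Ioi_b_mul_deriv hb0 hbint hblim] at hG
  linarith

/-- **The exact centre law of the rung-2 strain(+swirl) sector** (AGL-RUNG2-STRUCTURE §3):
if the sector equation `aₜ = ν𝓛₇a + q` is read at the centre with `(𝓛₇a)(0) = 7 a″(0)` (even `C²` germ) — i.e.
`ȧ₀ = ν · 7a″(0) + q(0)` — and `q` is the decaying potential of `centre_value_of_poisson`, then
`ȧ₀ = 7ν a″(0) − (15/14) a₀² − (2/15) b₀²`; in physical centre variables `s = 3a₀` (axial strain), `Ω = b₀`: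
`ṡ = −(5/14) s² − (2/5) Ω² + 21ν a″(0)` — restricted Euler's `(−½, −⅔)` renormalised to `(−5/14, −2/5)`. -/
theorem centreLaw {ν a0dot a0 app0 b0 q0 : ℝ} (hread : a0dot = ν * (7 * app0) + q0)
    (hq0 : q0 = -(15 / 14) * a0 ^ 2 - (2 / 15) * b0 ^ 2) :
    a0dot = 7 * ν * app0 - (15 / 14) * a0 ^ 2 - (2 / 15) * b0 ^ 2 ∧
      3 * a0dot = -(5 / 14) * (3 * a0) ^ 2 - (2 / 5) * b0 ^ 2 + 21 * ν * app0 := by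
  subst hq0
  subst hread
  constructor <;> ring

/-- **Criticality of the centre law (the number `196/15`).**  For a Gaussian-equivalent germ
`a″(0) = −2a₀/ℓ²` (`ℓ² > 0` the curvature width², `a₀ < 0` axial compression, no swirl) the centre law reads
`ȧ₀ = −(15/14)a₀² − 14ν a₀/ℓ² = −|a₀|·[(15/14)|a₀| − 14ν/ℓ²]`, so the compression AMPLIFIES (`ȧ₀ < 0`) iff
`|a₀| ℓ² > 196ν/15` — the strain Reynolds number threshold read in every SECTOR-1c / PROBE-1 run at the turn. -/
theorem centreLaw_amplifies_iff {ν a0 ell2 a0dot : ℝ} (hell : 0 < ell2) (ha : a0 < 0)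
    (hlaw : a0dot = 7 * ν * (-2 * a0 / ell2) - (15 / 14) * a0 ^ 2) :
    a0dot < 0 ↔ 196 * ν / 15 < |a0| * ell2 := by
  rw [abs_of_neg ha]
  have key : a0dot = (-a0) * ((14 * ν - (15 / 14) * ((-a0) * ell2))) / ell2 := by
    rw [hlaw]
    field_simp
    ring
  rw [key]
  have hna : 0 < -a0 := by linarith
  rw [mul_div_assoc]
  rw [mul_neg_iff]
  constructor
  · rintro (⟨_, h⟩ | ⟨h, _⟩)
    · have : 14 * ν - 15 / 14 * (-a0 * ell2) < 0 := by
        rcases (div_neg_iff.mp h) with ⟨_, h2⟩ | ⟨h1, _⟩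
        · linarith
        · exact h1
      nlinarith
    · linarith
  · intro h
    left
    refine ⟨hna, ?_⟩
    apply div_neg_of_neg_of_pos _ hell
    nlinarith

end Summit.NavierStokesRegularity.RungBlowupCofinalStrainSectorCentreLaw
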